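import Summits.QuantumFields.YangMills.Theorems.SwapVirialDeficitZeroModeSigmaFourSmallBallLimit
import HarnessLib

/-!
# The LEADER DOMINATOR at an arbitrary threshold (brick J4, leader half, of memo-24197-massive-mode-rung): w3 g63's `sigmaDom`, dilated
# (free-hands support of ⟨stmt-QuantumFields-24197⟩ `SwapVirialDeficit.SwapGluedStiffness`; companion of ✓`BlowUp.smallBall_limit_real_of_blowUp_of_weight`)

In the joint blow-up at scale `t = √u` the event `F ≤ r·u` forces (✓`SwapRing.swapCommBox_of_swapRingDeficit`) the six leader relations below `R·t` with a
threshold `R = R(L, r)` that is NOT `≤ 1` (`R ≈ 60L³√r` up to the Frobenius/quaternion factor), i.e. the leaders' cone coordinates into w3 g63's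
`rescaledSigmaR R t A = (dil3 t)⁻¹(transSet (R·t) A ∩ ball3)` (✓`rescaledSigmaR_def`; their ✓`rescaledSigmaR_subset` covers only `R ≤ 1`).  This file supplies
the domination for EVERY `R > 0` by dilating the `t`-free dominator:

* §1 `dil3_dil3`, `dil3_one'`, `rescaledSigmaR_eq_preimage_dil3` — `dil3 s ∘ dil3 s' = dil3 (s·s')`, hence `rescaledSigmaR R t A = (dil3 R⁻¹)⁻¹(rescaledSigma (R·t) A)`;
* §2 ★★ `indicator_rescaledSigmaR_le_sigmaDom_dil3` — `𝟙_{rescaledSigmaR R t A(a)}(w) ≤ sigmaDom A(a) (dil3 R⁻¹ w)` (`t, R > 0`, `a ≠ 0`, `w.1.1 ≠ 0`;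
  ✓`indicator_rescaledSigma_axis_le_sigmaDom` at threshold `R·t`);
* §3 ★★ `lintegral_sigmaDom_dil3_inv` — `∫⁻ sigmaDom A(a) (dil3 R⁻¹ w) d(cone ⊗ vol³) = R⁷ · ∫⁻ sigmaDom A(a) w d(cone ⊗ vol³) < ∞`
  (linear change of variables, ✓`det_dil3`, ✓`lintegral_prod_sigmaDom_ne_top`): the leader factor of the weight `Φ_r` of hypothesis (D′).

HONEST LABEL: measure theory on `ℍ⁴` (plan-level plumbing); NOT the fixed-`L` sharp law, NOT ⟨24197⟩; the Yang–Mills mass gap is NOT proved; no summit is proved by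
a line.  Seat ym-line-fcl-p3 g45 (cell ym-idea-1, free hands; item of record ⟨24085⟩ aside, untouched), `--supports stmt-QuantumFields-24197`.
THEOREMS ONLY (0 `def`, 0 `sorry`), standard axioms; the series' local `ℍ` instances.  References: [folklore].
-/

set_option autoImplicit false

noncomputable section

open MeasureTheory Quaternion Set
open scoped Quaternion ENNReal BigOperators
open Literature.MathematicalPhysics.QuantumLattice
open Literature.Analysis.Calculus (radialUnit radialUnit_def norm_radialUnit)
open Summit.QuantumFields.YangMills.Theorems.SwapTwistDeficit.ToronLog
open Summit.QuantumFields.YangMills.Theorems.SwapVirialDeficit.ZeroModeGroup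

attribute [local instance] Literature.Analysis.FluidPDE.Tao2016.quatMeasurableSpace
  Literature.Analysis.FluidPDE.Tao2016.quatBorelSpace
  Literature.MathematicalPhysics.QuantumLattice.secondCountableTopology_su2

namespace Summit.QuantumFields.YangMills.Theorems.SwapVirialDeficit.BlowUp

open Summit.QuantumFields.YangMills.Theorems.SwapVirialDeficit.ZeroModeSigma

/-! ## §1 Composition of the dilations -/

/-- `D_s (D_{s'} x) = D_{s·s'} x` for the pair dilation. [folklore] -/
theorem dilate_dilate (s s' : ℝ) (x : ℍ) : dilate s (dilate s' x) = dilate (s * s') x := by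
  rw [dilate_apply, dilate_apply, dilate_apply]
  ext <;> simp [mul_assoc]

/-- `D³_s (D³_{s'} z) = D³_{s·s'} z` for the imaginary dilation. [folklore] -/
theorem dilateIm_dilateIm (s s' : ℝ) (z : ℍ) : dilateIm s (dilateIm s' z) = dilateIm (s * s') z := by
  rw [dilateIm_apply, dilateIm_apply, dilateIm_apply]
  ext <;> simp [mul_assoc]

/-- `dil3 s ∘ dil3 s' = dil3 (s·s')`. [folklore] -/
theorem dil3_dil3 (s s' : ℝ) (w : (ℍ × ℍ) × ℍ) : dil3 s (dil3 s' w) = dil3 (s * s') w := by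
  rw [dil3_apply, dil3_apply, dil3_apply, dilate_dilate, dilate_dilate, dilateIm_dilateIm]

/-- `D_1 = id` for the pair dilation. [folklore] -/
theorem dilate_one_apply (x : ℍ) : dilate 1 x = x := by
  rw [dilate_apply]; ext <;> simp

/-- `D³_1 = id` for the imaginary dilation. [folklore] -/
theorem dilateIm_one_apply (z : ℍ) : dilateIm 1 z = z := by
  rw [dilateIm_apply]; ext <;> simp

/-- `dil3 1 = id`. [folklore] -/
theorem dil3_one' (w : (ℍ × ℍ) × ℍ) : dil3 1 w = w := by
  rw [dil3_apply, dilate_one_apply, dilate_one_apply, dilateIm_one_apply]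

/-- `dil3 R (dil3 R⁻¹ w) = w` and `dil3 R⁻¹ (dil3 R w) = w` for `R ≠ 0`. [folklore] -/
theorem dil3_dil3_inv {R : ℝ} (hR : R ≠ 0) (w : (ℍ × ℍ) × ℍ) : dil3 R (dil3 R⁻¹ w) = w ∧ dil3 R⁻¹ (dil3 R w) = w := by
  rw [dil3_dil3, dil3_dil3, mul_inv_cancel₀ hR, inv_mul_cancel₀ hR]
  exact ⟨dil3_one' w, dil3_one' w⟩

/-- ★ **The threshold-`R` event is the `R⁻¹`-dilated preimage of the threshold-`1` event at scale `R·t`**: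
`rescaledSigmaR R t A = (dil3 R⁻¹)⁻¹(rescaledSigma (R·t) A)` (`R ≠ 0`). [folklore] -/
theorem rescaledSigmaR_eq_preimage_dil3 {R : ℝ} (hR : R ≠ 0) (t : ℝ) (A : ℍ) :
    rescaledSigmaR R t A = (dil3 R⁻¹) ⁻¹' (rescaledSigma (R * t) A) := by
  ext w
  rw [rescaledSigmaR_def, rescaledSigma_def, Set.mem_preimage, Set.mem_preimage, Set.mem_preimage, dil3_dil3,
    show R * t * R⁻¹ = t by field_simp]

/-! ## §2 Domination at every threshold -/

/-- The pair dilation by a non-zero factor has trivial kernel. [folklore] -/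
theorem dilate_ne_zero {r : ℝ} (hr : r ≠ 0) {x : ℍ} (hx : x ≠ 0) : dilate r x ≠ 0 := by
  intro h
  apply hx
  have h' := (dil3_dil3_inv hr ((x, x), x)).2
  rw [dil3_apply, dil3_apply] at h'
  have hx' : dilate r⁻¹ (dilate r x) = x := (Prod.mk.inj (Prod.mk.inj h').1).1
  rw [h, map_zero] at hx'
  exact hx'.symm

/-- ★★ **Domination at threshold `R`**: for `t, R > 0`, a hub `a ≠ 0` and `w.1.1 ≠ 0`,
`𝟙_{rescaledSigmaR R t A(a)}(w) ≤ sigmaDom A(a) (dil3 R⁻¹ w)`, `A(a) = radialUnit (axisPoint a)` — w3 g63's `t`-free dominator (✓`indicator_rescaledSigma_axis_le_sigmaDom`)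
at threshold `R·t`, pulled back along `dil3 R⁻¹`. [folklore] -/
theorem indicator_rescaledSigmaR_le_sigmaDom_dil3 {R t : ℝ} (hR : 0 < R) (ht : 0 < t) {a : ℍ} (ha : a ≠ 0) (w : (ℍ × ℍ) × ℍ)
    (hx : w.1.1 ≠ 0) :
    (rescaledSigmaR R t (radialUnit (axisPoint a))).indicator (1 : (ℍ × ℍ) × ℍ → ℝ≥0∞) w ≤
      sigmaDom (radialUnit (axisPoint a)) (dil3 R⁻¹ w) := by
  have hx' : (dil3 R⁻¹ w).1.1 ≠ 0 := by
    rw [dil3_apply]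
    exact dilate_ne_zero (inv_ne_zero hR.ne') hx
  have h := indicator_rescaledSigma_axis_le_sigmaDom (mul_pos hR ht) ha (dil3 R⁻¹ w) hx'
  rw [rescaledSigmaR_eq_preimage_dil3 hR.ne']
  by_cases hw : w ∈ (dil3 R⁻¹) ⁻¹' rescaledSigma (R * t) (radialUnit (axisPoint a))
  · rw [Set.indicator_of_mem hw]
    rw [Set.indicator_of_mem (Set.mem_preimage.1 hw)] at h
    exact h
  · rw [Set.indicator_of_notMem hw]
    exact bot_le

/-- ★★ The same, jointly in the hub: for `(cone ⊗ vol³)`-a.e. `q = (a, w)` and ALL `t > 0`,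
`q.2 ∈ rescaledSigmaR R t A(q.1) → 1 ≤ sigmaDom A(q.1) (dil3 R⁻¹ q.2)`. [folklore] -/
theorem ae_one_le_sigmaDom_dil3_of_mem {R : ℝ} (hR : 0 < R) :
    ∀ᵐ q : ℍ × ((ℍ × ℍ) × ℍ) ∂(coneMeasure.prod (((volume : Measure ℍ).prod volume).prod volume)),
      ∀ t : ℝ, 0 < t → q.2 ∈ rescaledSigmaR R t (radialUnit (axisPoint q.1)) → 1 ≤ sigmaDom (radialUnit (axisPoint q.1)) (dil3 R⁻¹ q.2) := by
  haveI := isProbabilityMeasure_coneMeasure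
  haveI := sFinite_vol3
  -- the null sets: hub `a = 0` and first pair letter `x = 0`
  have h1 : ∀ᵐ q : ℍ × ((ℍ × ℍ) × ℍ) ∂(coneMeasure.prod (((volume : Measure ℍ).prod volume).prod volume)), q.1 ≠ 0 :=
    (Measure.quasiMeasurePreserving_fst (μ := coneMeasure) (ν := ((volume : Measure ℍ).prod volume).prod volume)).ae ae_ne_zero_coneMeasure
  have hx0 : ∀ᵐ x : ℍ ∂(volume : Measure ℍ), x ≠ 0 := by
    rw [ae_iff]
    simpa only [ne_eq, not_not, Set.setOf_eq_eq_singleton] using (measure_singleton (0 : ℍ) : (volume : Measure ℍ) {0} = 0)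
  have h2 : ∀ᵐ q : ℍ × ((ℍ × ℍ) × ℍ) ∂(coneMeasure.prod (((volume : Measure ℍ).prod volume).prod volume)), q.2.1.1 ≠ 0 := by
    have hw : ∀ᵐ w : (ℍ × ℍ) × ℍ ∂(((volume : Measure ℍ).prod volume).prod volume), w.1.1 ≠ 0 :=
      (Measure.quasiMeasurePreserving_fst.comp Measure.quasiMeasurePreserving_fst).ae hx0
    exact (Measure.quasiMeasurePreserving_snd (μ := coneMeasure) (ν := ((volume : Measure ℍ).prod volume).prod volume)).ae hw
  filter_upwards [h1, h2] with q ha hx t ht hmem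
  have h := indicator_rescaledSigmaR_le_sigmaDom_dil3 hR ht ha q.2 hx
  rw [Set.indicator_of_mem hmem, Pi.one_apply] at h
  exact h

/-! ## §3 The dilated dominator has finite integral -/

/-- ★ **Change of variables along `dil3 R⁻¹`**: `∫⁻ H (dil3 R⁻¹ w) dvol³ = R⁷ · ∫⁻ H dvol³` (`R > 0`, measurable `H ≥ 0`). [folklore] -/
theorem lintegral_comp_dil3_inv {R : ℝ} (hR : 0 < R) (H : (ℍ × ℍ) × ℍ → ℝ≥0∞) (hH : Measurable H) :
    ∫⁻ w, H (dil3 R⁻¹ w) ∂(((volume : Measure ℍ).prod volume).prod volume) = ENNReal.ofReal (R ^ 7) * ∫⁻ w, H w ∂(((volume : Measure ℍ).prod volume).prod volume) := by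
  have hvol : (((volume : Measure ℍ).prod volume).prod volume) = (volume : Measure ((ℍ × ℍ) × ℍ)) := rfl
  rw [hvol]
  haveI := isAddHaarMeasure_volume3
  have hRi : R⁻¹ ≠ 0 := inv_ne_zero hR.ne'
  have hdet : LinearMap.det (dil3 R⁻¹) ≠ 0 := by rw [det_dil3]; exact pow_ne_zero _ hRi
  have hmap : (volume : Measure ((ℍ × ℍ) × ℍ)).map (dil3 R⁻¹) = ENNReal.ofReal (R ^ 7) • (volume : Measure ((ℍ × ℍ) × ℍ)) := by
    rw [Measure.map_linearMap_addHaar_eq_smul_addHaar volume hdet, det_dil3, inv_pow, inv_inv, abs_of_pos (by positivity)]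
  rw [← lintegral_map hH (measurable_dil3 R⁻¹), hmap, lintegral_smul_measure, smul_eq_mul]

/-- ★★ **The dilated leader dominator has finite integral**: `∫⁻ sigmaDom A(a) (dil3 R⁻¹ w) d(cone ⊗ vol³) = R⁷ · ∫⁻ sigmaDom A(a) w d(cone ⊗ vol³) ≠ ∞`
(✓`lintegral_prod_sigmaDom_ne_top`). [folklore] -/
theorem lintegral_sigmaDom_dil3_inv {R : ℝ} (hR : 0 < R) :
    ∫⁻ q, sigmaDom (radialUnit (axisPoint q.1)) (dil3 R⁻¹ q.2) ∂(coneMeasure.prod (((volume : Measure ℍ).prod volume).prod volume)) =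
      ENNReal.ofReal (R ^ 7) * ∫⁻ q, sigmaDom (radialUnit (axisPoint q.1)) q.2 ∂(coneMeasure.prod (((volume : Measure ℍ).prod volume).prod volume)) ∧
    ∫⁻ q, sigmaDom (radialUnit (axisPoint q.1)) (dil3 R⁻¹ q.2) ∂(coneMeasure.prod (((volume : Measure ℍ).prod volume).prod volume)) ≠ ∞ := by
  haveI := isProbabilityMeasure_coneMeasure
  haveI := sFinite_vol3
  have hT : Measurable fun q : ℍ × ((ℍ × ℍ) × ℍ) => (q.1, dil3 R⁻¹ q.2) := measurable_fst.prodMk ((measurable_dil3 R⁻¹).comp measurable_snd)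
  have hmD' := measurable_sigmaDom_hub.comp hT
  have hmD : Measurable fun q : ℍ × ((ℍ × ℍ) × ℍ) => sigmaDom (radialUnit (axisPoint q.1)) (dil3 R⁻¹ q.2) := hmD'
  have heq : ∫⁻ q, sigmaDom (radialUnit (axisPoint q.1)) (dil3 R⁻¹ q.2) ∂(coneMeasure.prod (((volume : Measure ℍ).prod volume).prod volume)) =
      ENNReal.ofReal (R ^ 7) * ∫⁻ q, sigmaDom (radialUnit (axisPoint q.1)) q.2 ∂(coneMeasure.prod (((volume : Measure ℍ).prod volume).prod volume)) := by
    rw [lintegral_prod _ hmD.aemeasurable, lintegral_prod _ measurable_sigmaDom_hub.aemeasurable]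
    have hin : ∀ a : ℍ, ∫⁻ w, sigmaDom (radialUnit (axisPoint a)) (dil3 R⁻¹ w) ∂(((volume : Measure ℍ).prod volume).prod volume) =
        ENNReal.ofReal (R ^ 7) * ∫⁻ w, sigmaDom (radialUnit (axisPoint a)) w ∂(((volume : Measure ℍ).prod volume).prod volume) :=
      fun a => lintegral_comp_dil3_inv hR _ (measurable_sigmaDom _)
    simp only [hin]
    rw [lintegral_const_mul _ measurable_sigmaDom_hub.lintegral_prod_right']
  refine ⟨heq, ?_⟩
  rw [heq]
  exact ENNReal.mul_ne_top ENNReal.ofReal_ne_top lintegral_prod_sigmaDom_ne_top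

end Summit.QuantumFields.YangMills.Theorems.SwapVirialDeficit.BlowUp

end
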